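import Summits.ValiantsHypothesis.ValiantsHypothesis.Theorems.OrderedCountWindowPairs
import HarnessLib
import HarnessLib.Audit

/-!
# Ordered count window — the RESERVOIR THEOREM: the count window closes modulo one balancing lemma
(lens 6, g8; conditional assembly requested by the critic, R3 2026-08-30T03:26:18Z)

**Theorem (kernel, conditional on `BalancedSegments`).** For EVERY support function `t`, the dial
`A_t = PerNotSumOrdered t` holds: `perNotSumOrdered_all`.  Equivalently: for every `c`, for
infinitely many `N`, `per_N` is not a sum of ordered set-multilinear ABPs (ANY number of summands, in
ANY block orders) of total width `≤ N^c + c` — a `ΣosmABP` lower bound for the permanent of EVERY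
support, the question printed open by Arvind–Raja (sub-linearly many ROABPs only) and by
Chatterjee–Kush–Saraf–Shpilka (super-polynomial support only for their own polynomial `F_{n,n}` /
`G_{n,d}` in VBP).  Quantitatively (`two_pow_le_pow_of_isSumOrdered`): if `per_{2P}` (`2P = q r`,
`r ≥ 1024`) is a `ΣosmABP` of total width `W` with `W (2P+1) < 2^q`, then `2^{⌊q ⌊√r/32⌋ / 4⌋} ≤ W^{q+1}`;
along `2P = 262144 k⁴` this gives total width `≥ 2^{k/2} = 2^{Ω(N^{1/4})}`.

**Proof (all kernel except the typed lemma).** Restrict `per_{2P}` to the ALPHABET-2 PAIR RESERVOIR of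
a matching `e : S ≃ Sᶜ` (`Theorems/OrderedCountWindowPairs.lean`): the restricted tensor is the pair
tensor, its flattening across `S` has rank `2^P`, and it is still the sum of the restricted programs
with the same orders and widths (`pair_restriction`).  Cut every program into `q` segments of `r`
layers; by the segment rank bound (`Theorems/OrderedCountWindowSegmentRank.lean`) program `i`
contributes rank `≤ w_i^{q+1} 2^{∑_m min(|A_{i,m} ∩ S|, |A_{i,m} \ S|)} ≤ w_i^{q+1} 2^{P - h}` as soon as
the cut `S` makes the segments of EVERY (positive-width) program imbalanced by `2 ∑_m imb ≥ q ⌊√r/32⌋`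
in total (`h = ⌊q ⌊√r/32⌋/4⌋`; `2 min + imb = |A|`).  That such a cut with `|S| = P` exists whenever the
number of programs is `< 2^q / (2P+1)` is the purely combinatorial BALANCING LEMMA `BalancedSegments`
(§1; a Chernoff–plus–union-bound count, the `k = 1`, alphabet-2 core of the proof of CKSS Lemma 4 —
TYPED HERE AS A PROBLEM-SIDE `@[conjecture]` PIECE, not a Literature fact: it is proof-extracted, not a
printed statement).  Summing, `2^P ≤ W^{q+1} 2^{P-h}`.

Pieces and tags (workshop contract): `BalancedSegments` — TAG WEAKER (pure finite combinatorics,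
ATTACKABLE: prove it; cheapest falsifier: exhaustive check at toy sizes is vacuous because of `r ≥ 1024`,
so the falsifier is the binomial count itself); `perNotSumOrdered_all` — conditional kernel assembly
`BalancedSegments → ∀ t, A_t`; in particular `BalancedSegments → DecompCycle1.PerNotSumOrderedId`
(aside stmt-ValiantsHypothesis-26003, `= PerNotSumOrdered id` by `rfl`).  Nothing here bears on
`VP ≠ VNP` beyond deciding the dial: the same restriction treats `det_N` identically (signs only), so the
ordered-count window is a regime where `per` and `det` behave alike (LESSON 6).

[cite: ChatterjeeKushSarafShpilka2024, Lemma 4, Claim 1, Thm 3, §1.2] [cite: ArvindRaja2016, Cor 12, §7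
(open: polynomially many ROABPs)] [cite: Nisan1991Noncommutative, §2]
-/

noncomputable section

namespace Summit.ValiantsHypothesis.ValiantsHypothesis.Theorems.OrderedCountWindow

open Literature.Computability.AlgebraicComplexity Matrix

variable {F : Type*} [Field F]

/-! ## §1 Imbalance and the balancing lemma (typed piece) -/

/-- The IMBALANCE of a segment `A` with respect to the cut `S`: `| |A ∩ S| - |A \ S| |`.
[cite: ChatterjeeKushSarafShpilka2024, Def 4 (`S`-`k`-balanced), Def 5] -/
def imb {N : ℕ} (S A : Finset (Fin N)) : ℕ :=
  (A ∩ S).card.dist (A \ S).card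

/-- **Balancing lemma `BalancedSegments` (Lemma C of the workshop note; PIECE, typed, OPEN).**  For
families `i ∈ ι` of `q` pairwise disjoint `r`-subsets `A i 0, …, A i (q-1)` of a `2P`-set
(`r ≥ 1024`), if `#ι · (2P+1) < 2^q` then some `P`-subset `S` makes every family imbalanced in total:
`q ⌊√r/32⌋ ≤ 2 ∑_m imb S (A i m)` for every `i`.  (Proof sketch, not kernel: for a uniformly random
subset `S` each segment has `imb < ⌊√r/32⌋` with probability `≤ 1/16` independently across the disjoint
segments of one family, so a family has more than `q/2` such segments with probability `≤ 2^{-q-2}`;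
condition on `|S| = P` at cost `2P+1` and take a union bound over `ι` — the `k = 1` core of the proof
of [cite: ChatterjeeKushSarafShpilka2024, Lemma 4 (p.15)], extracted; NOT a statement in print, hence
a problem-side conjecture and not a Literature fact.) -/
@[conjecture] def BalancedSegments : Prop :=
  ∀ (ι : Type) [Fintype ι] (P q r : ℕ) (A : ι → Fin q → Finset (Fin (P + P))),
    1024 ≤ r → Fintype.card ι * (P + P + 1) < 2 ^ q → (∀ i m, (A i m).card = r) →
      (∀ i m m', m ≠ m' → Disjoint (A i m) (A i m')) →
        ∃ S : Finset (Fin (P + P)), S.card = P ∧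
          ∀ i, q * (Nat.sqrt r / 32) ≤ 2 * ∑ m, imb S (A i m)

/-- Bookkeeping: `2 · min(|A ∩ S|, |A \ S|) + imb S A = |A|`. [folklore] -/
theorem two_mul_min_add_imb {N : ℕ} (S A : Finset (Fin N)) :
    2 * min (A ∩ S).card (A \ S).card + imb S A = A.card := by
  rw [← Finset.card_inter_add_card_sdiff A S]
  unfold imb Nat.dist
  omega

/-- Bookkeeping for one program: if its `q` segments have total size `2P` and total imbalance
`≥ q λ / 2`, then `∑_m min + ⌊q λ / 4⌋ ≤ P`. [folklore] -/
theorem sum_min_add_le {N q P lam : ℕ} (S : Finset (Fin N)) (A : Fin q → Finset (Fin N))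
    (hcard : ∑ m, (A m).card = P + P) (himb : q * lam ≤ 2 * ∑ m, imb S (A m)) :
    ∑ m, min (A m ∩ S).card (A m \ S).card + q * lam / 4 ≤ P := by
  have key : 2 * ∑ m, min (A m ∩ S).card (A m \ S).card + ∑ m, imb S (A m) = P + P := by
    rw [← hcard, Finset.mul_sum, ← Finset.sum_add_distrib]
    exact Finset.sum_congr rfl fun m _ => two_mul_min_add_imb S (A m)
  omega

/-! ## §2 The reservoir theorem at a fixed size -/

/-- **Reservoir theorem (finite form, conditional on `BalancedSegments`).**  If `per_{2P}`, `2P = q r`,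
`r ≥ 1024`, is a sum of ordered set-multilinear ABPs of total width `≤ W` with `W (2P+1) < 2^q`, then
`2^{⌊q ⌊√r/32⌋ / 4⌋} ≤ W^{q+1}`. [cite: ChatterjeeKushSarafShpilka2024, Lemma 4, Claim 1 (the method);
ArvindRaja2016, §7 (the question for PER)] -/
theorem two_pow_le_pow_of_isSumOrdered (hC : BalancedSegments) {P q r t W : ℕ} (hN : P + P = q * r)
    (hr : 1024 ≤ r) (hW : W * (P + P + 1) < 2 ^ q) (h : IsSumOrdered F (P + P) t W) :
    2 ^ (q * (Nat.sqrt r / 32) / 4) ≤ W ^ (q + 1) := by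
  classical
  obtain ⟨σ, w, hsum, hall⟩ := pair_restriction h
  have hwW : ∀ i, w i ≤ W := fun i =>
    (Finset.single_le_sum (fun i _ => Nat.zero_le (w i)) (Finset.mem_univ i)).trans hsum
  -- the positive-width programs
  let ι := {i : Fin t // 0 < w i}
  have hι : Fintype.card ι ≤ W := by
    rw [Fintype.card_subtype]
    calc (Finset.univ.filter fun i => 0 < w i).card
        = ∑ i ∈ Finset.univ.filter (fun i => 0 < w i), 1 := by simp
      _ ≤ ∑ i ∈ Finset.univ.filter (fun i => 0 < w i), w i :=
          Finset.sum_le_sum fun i hi => (Finset.mem_filter.1 hi).2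
      _ ≤ ∑ i, w i := Finset.sum_le_sum_of_subset (Finset.filter_subset _ _)
      _ ≤ W := hsum
  have hι' : Fintype.card ι * (P + P + 1) < 2 ^ q :=
    lt_of_le_of_lt (Nat.mul_le_mul_right _ hι) hW
  -- their segments
  let τ : Fin t → Fin (q * r) → Fin (P + P) := fun i p => σ i (Fin.cast hN.symm p)
  have hτ : ∀ i, Function.Injective (τ i) := fun i =>
    (σ i).injective.comp (Fin.cast_injective _)
  let A : ι → Fin q → Finset (Fin (P + P)) := fun i m => segment (τ i.1) m
  obtain ⟨S, hS, himb⟩ := hC ι P q r A hr hι' (fun i m => card_segment (hτ i.1) m)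
    (fun i m m' hmm' => disjoint_segment (hτ i.1) hmm')
  -- the matching
  have hcS : Fintype.card {c // c ∈ S} = P := by rw [Fintype.card_coe, hS]
  have hcSc : Fintype.card {c // c ∉ S} = P := by
    rw [Fintype.card_subtype_compl, Fintype.card_fin, hcS]
    omega
  let e : {c // c ∈ S} ≃ {c // c ∉ S} := Fintype.equivOfCardEq (hcS.trans hcSc.symm)
  obtain ⟨B', hB', hT⟩ := hall S e
  -- the flattening of the pair tensor is the sum of the program flattenings
  have hflat : setFlattening S (pairTensor (F := F) S e) = ∑ i, setFlattening S (B' i) := by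
    rw [← setFlattening_sum]
    congr 1
    funext j
    exact (hT j).symm
  -- per-program bound
  set hh := q * (Nat.sqrt r / 32) / 4 with hhh
  have hprog : ∀ i, (setFlattening S (B' i)).rank * 2 ^ hh ≤ w i ^ (q + 1) * 2 ^ P := by
    intro i
    rcases Nat.eq_zero_or_pos (w i) with h0 | hpos
    · have hz : B' i = fun _ => 0 := by
        have hB0 := hB' i
        rw [h0] at hB0
        exact eq_zero_of_hasOsmWidthLE_zero hB0
      rw [hz, setFlattening_zero, Matrix.rank_zero, zero_mul]
      exact Nat.zero_le _
    · have hprog' := rank_setFlattening_le_of_hasOsmWidthLE (n := 2) (τ i)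
        (HasOsmWidthLE.castLayers hN (hB' i)) S
      have hbook : ∑ m : Fin q, min (segment (τ i) m ∩ S).card (segment (τ i) m \ S).card + hh ≤ P := by
        refine sum_min_add_le S (fun m => segment (τ i) m) ?_ (himb ⟨i, hpos⟩)
        rw [Finset.sum_congr rfl fun m _ => card_segment (hτ i) m]
        simp [hN]
      calc (setFlattening S (B' i)).rank * 2 ^ hh
          ≤ (w i ^ (q + 1) * 2 ^ ∑ m : Fin q, min (segment (τ i) m ∩ S).card
              (segment (τ i) m \ S).card) * 2 ^ hh := Nat.mul_le_mul_right _ hprog'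
        _ = w i ^ (q + 1) * 2 ^ (∑ m : Fin q, min (segment (τ i) m ∩ S).card
              (segment (τ i) m \ S).card + hh) := by rw [mul_assoc, ← pow_add]
        _ ≤ w i ^ (q + 1) * 2 ^ P :=
            Nat.mul_le_mul_left _ (Nat.pow_le_pow_right (by norm_num) hbook)
  -- sum up
  have hmain : 2 ^ P * 2 ^ hh ≤ (∑ i, w i ^ (q + 1)) * 2 ^ P := by
    calc 2 ^ P * 2 ^ hh = (setFlattening S (pairTensor (F := F) S e)).rank * 2 ^ hh := by
            rw [rank_setFlattening_pairTensor_eq S e hcSc]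
      _ ≤ (∑ i, (setFlattening S (B' i)).rank) * 2 ^ hh := by
            rw [hflat]
            exact Nat.mul_le_mul_right _ (rank_sum_le _ _)
      _ = ∑ i, (setFlattening S (B' i)).rank * 2 ^ hh := Finset.sum_mul _ _ _
      _ ≤ ∑ i, w i ^ (q + 1) * 2 ^ P := Finset.sum_le_sum fun i _ => hprog i
      _ = (∑ i, w i ^ (q + 1)) * 2 ^ P := (Finset.sum_mul _ _ _).symm
  have hsumpow : ∑ i, w i ^ (q + 1) ≤ W ^ (q + 1) := by
    calc ∑ i, w i ^ (q + 1) = ∑ i, w i * w i ^ q := Finset.sum_congr rfl fun i _ => by ring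
      _ ≤ ∑ i, w i * W ^ q := Finset.sum_le_sum fun i _ =>
          Nat.mul_le_mul_left _ (Nat.pow_le_pow_left (hwW i) q)
      _ = (∑ i, w i) * W ^ q := (Finset.sum_mul _ _ _).symm
      _ ≤ W * W ^ q := Nat.mul_le_mul_right _ hsum
      _ = W ^ (q + 1) := by ring
  have h2 : 2 ^ hh ≤ ∑ i, w i ^ (q + 1) := by
    rw [mul_comm] at hmain
    exact Nat.le_of_mul_le_mul_right hmain (by positivity)
  exact h2.trans hsumpow

/-! ## §3 The dial `A_t` for every `t`, conditionally -/

/-- Growth input: a p-bounded function drops below `2^k` at some `k ≥ 1`. [folklore] -/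
theorem exists_lt_two_pow_of_isPBounded {f : ℕ → ℕ} (hf : IsPBounded f) :
    ∃ k, 1 ≤ k ∧ f k < 2 ^ k := by
  by_contra hk
  push Not at hk
  exact not_isPBounded_of_two_pow_le 0 1 (fun n hn => by simpa using hk n hn) hf

/-- **The reservoir theorem: modulo `BalancedSegments`, the ordered-count window is CLOSED — `A_t` holds
for EVERY support function `t`** (along `N = 262144 k⁴`: `q = 16k²`, `r = 16384 k²`, `⌊√r/32⌋ = 4k`,
exponent `16k³`, so total width `W` with `W² ≥ 2^k`). [cite: ChatterjeeKushSarafShpilka2024, Thm 3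
(the method, for their `G_{n,d}`); ArvindRaja2016, Cor 12, §7 (open for PER beyond sub-linear support)] -/
theorem perNotSumOrdered_all (hC : BalancedSegments) (t : ℕ → ℕ) : PerNotSumOrdered t := by
  intro c
  by_contra hcon
  push Not at hcon
  -- growth bookkeeping in `k`
  let Nk : ℕ → ℕ := fun k => 262144 * k ^ 4
  let g : ℕ → ℕ := fun k => Nk k ^ c + c
  let f : ℕ → ℕ := fun k => g k * (Nk k + 1) + g k ^ 2
  have hNk : IsPBounded Nk :=
    IsPBounded.mul_holds (IsPBounded.const 262144) (IsPBounded.pow_holds IsPBounded.id 4)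
  have hg : IsPBounded g := IsPBounded.add_holds (IsPBounded.pow_holds hNk c) (IsPBounded.const c)
  have hf : IsPBounded f :=
    IsPBounded.add_holds (IsPBounded.mul_holds hg (IsPBounded.add_holds hNk (IsPBounded.const 1)))
      (IsPBounded.pow_holds hg 2)
  obtain ⟨k, hk, hfk⟩ := exists_lt_two_pow_of_isPBounded hf
  -- the parameters
  have hN : 131072 * k ^ 4 + 131072 * k ^ 4 = (16 * k ^ 2) * (16384 * k ^ 2) := by ring
  have hNk' : Nk k = 131072 * k ^ 4 + 131072 * k ^ 4 := by simp only [Nk]; ring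
  have hr : 1024 ≤ 16384 * k ^ 2 := by nlinarith
  have hkq : k ≤ 16 * k ^ 2 := by nlinarith
  have hW : g k * (131072 * k ^ 4 + 131072 * k ^ 4 + 1) < 2 ^ (16 * k ^ 2) := by
    rw [← hNk']
    calc g k * (Nk k + 1) ≤ f k := Nat.le_add_right _ _
      _ < 2 ^ k := hfk
      _ ≤ 2 ^ (16 * k ^ 2) := Nat.pow_le_pow_right (by norm_num) hkq
  have hS : IsSumOrdered ℂ (131072 * k ^ 4 + 131072 * k ^ 4) (t (Nk k)) (g k) := by
    have := hcon (Nk k)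
    rw [hNk'] at this
    simpa only [g, hNk'] using this
  have hmain := two_pow_le_pow_of_isSumOrdered hC hN hr hW hS
  -- evaluate the exponent: `⌊√(16384 k²)⌋ = 128 k`, `16k² · 4k / 4 = 16 k³`
  have hsqrt : Nat.sqrt (16384 * k ^ 2) = 128 * k := by
    rw [show 16384 * k ^ 2 = (128 * k) * (128 * k) by ring, Nat.sqrt_eq]
  have hexp : 16 * k ^ 2 * (Nat.sqrt (16384 * k ^ 2) / 32) / 4 = k * (16 * k ^ 2) := by
    rw [hsqrt, show 128 * k = 32 * (4 * k) by ring, Nat.mul_div_cancel_left _ (by norm_num : 0 < 32),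
      show 16 * k ^ 2 * (4 * k) = 4 * (k * (16 * k ^ 2)) by ring,
      Nat.mul_div_cancel_left _ (by norm_num : 0 < 4)]
  rw [hexp] at hmain
  -- `2^{k · 16k²} ≤ W^{16k²+1} ≤ (W²)^{16k²}` forces `2^k ≤ W²`, contradicting `W² < 2^k`
  have hW1 : 1 ≤ g k := one_le_of_isSumOrdered hS
  have hq0 : 16 * k ^ 2 ≠ 0 := by positivity
  have hle : g k ^ (16 * k ^ 2 + 1) ≤ (g k ^ 2) ^ (16 * k ^ 2) := by
    rw [← pow_mul]
    exact Nat.pow_le_pow_right hW1 (by nlinarith)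
  have h2k : 2 ^ k ≤ g k ^ 2 := by
    rw [← Nat.pow_le_pow_iff_left hq0, ← pow_mul]
    exact hmain.trans hle
  have hlt : g k ^ 2 < 2 ^ k := lt_of_le_of_lt (Nat.le_add_left _ _) hfk
  exact absurd (h2k.trans_lt hlt) (lt_irrefl _)

/-- In particular (modulo `BalancedSegments`) the first window point `A_id` — the route's aside
`DecompCycle1.PerNotSumOrderedId` (stmt-ValiantsHypothesis-26003), definitionally `PerNotSumOrdered id` —
and the polynomial-support points `A_{n ↦ n^k}`. [cite: ArvindRaja2016, §7 (Remark 11: open problem)] -/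
theorem perNotSumOrdered_pow (hC : BalancedSegments) (k : ℕ) : PerNotSumOrdered fun n => n ^ k :=
  perNotSumOrdered_all hC _

end Summit.ValiantsHypothesis.ValiantsHypothesis.Theorems.OrderedCountWindow
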